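import Literature.NumberTheory.Automorphic.PairLFunctionPolesRepDataHolds
import Literature.NumberTheory.Automorphic.PairLFunctionPolesEqConjLeTwo
import HarnessLib

/-!
# Arthur–Clozel (2.3) for Borel–Jacquet data in rank `2`, unconditionally

Topic `NumberTheory/Automorphic`; namespace `Literature.NumberTheory.Automorphic`. Theorems only. The
rank-`n` form `JacquetShalika1981_partialPairL_pole_repData_rank` of the named fact
`JacquetShalika1981_partialPairL_pole_repData` (`PairLFunctionPolesRepDataHolds`: for cuspidal `π`, `σ`
on `GL_n(𝔸_F)` given as Borel–Jacquet data, unitary Satake families and `s₀ ∈ X`, the limit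
`lim_{s → s₀} (s - s₀) L^S(s, π ⊗ σ)` exists and is non-zero) takes as input the `L²` statement
`JacquetShalika1981_partialPairL_pole_of_eq_conj` in rank `n` for all automorphic measures; in rank
`2` that input is now the theorem `JacquetShalika1981_partialPairL_pole_of_eq_conj_holds_two`
(`KirillovToFirstMomentGL2`), whence the unconditional rank-`2` statement
`JacquetShalika1981_partialPairL_pole_repData_rank_two` (and the same in rank `1`).

## References

* J. Arthur, L. Clozel, Ann. of Math. Stud. 120 (1989), Ch. 3 §2, (2.3), p. 171 [ArthurClozelAMS120].
* H. Jacquet, J. A. Shalika, Amer. J. Math. 103 (1981), II, Prop. 3.6 [JacquetShalikaAJM1981II].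
-/

noncomputable section

open MeasureTheory Filter Topology NumberField IsDedekindDomain
open scoped Topology

namespace Literature.NumberTheory.Automorphic

open AdelicGroupData

/-- **Arthur–Clozel (2.3) for Borel–Jacquet data on `GL_2`, unconditionally.**
[cite: ArthurClozelAMS120, Ch. 3 §2, (2.3), p. 171] -/
theorem JacquetShalika1981_partialPairL_pole_repData_rank_two {F : Type} [Field F] [NumberField F]
    (hF : isCompact_glFiniteIntegralLevel 2 F) (π π' : CuspidalAutomorphicRepData 2 F hF) :
    ∃ S₀ : Set (HeightOneSpectrum (𝓞 F)), S₀.Finite ∧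
      ∀ {S : Set (HeightOneSpectrum (𝓞 F))} (_hS : S.Finite) (_hS₀ : S₀ ⊆ S)
        {α β : SatakeFamily F} (_hα : ∀ w ∉ S, π.1.HasSatakeParamAt w (α w))
        (_hβ : ∀ w ∉ S, π'.1.HasSatakeParamAt w (β w))
        (_hu : ∀ w ∉ S, ‖(α w).prod‖ = 1) (_hu' : ∀ w ∉ S, ‖(β w).prod‖ = 1)
        {s₀ : ℂ} (_hs₀ : s₀.re = 1)
        (_hX : ∀ᶠ w in cofinite,
          (α w).map (((w.residueCard : ℂ) ^ (1 - s₀)) * ·) = (β w).map (·⁻¹)),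
        ∃ c : ℂ, c ≠ 0 ∧
          Tendsto (fun s => (s - s₀) * partialPairL S α β s) (𝓝[{s : ℂ | 1 < s.re}] s₀) (𝓝 c) :=
  JacquetShalika1981_partialPairL_pole_repData_rank
    (fun _ _ => JacquetShalika1981_partialPairL_pole_of_eq_conj_holds_two) hF two_pos π π'

/-- **Arthur–Clozel (2.3) for Borel–Jacquet data on `GL_n`, `n ≤ 2`, unconditionally.**
[cite: ArthurClozelAMS120, Ch. 3 §2, (2.3), p. 171] -/
theorem JacquetShalika1981_partialPairL_pole_repData_rank_of_le_two {n : ℕ} {F : Type} [Field F] [NumberField F]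
    (hn2 : n ≤ 2) (hF : isCompact_glFiniteIntegralLevel n F) (hn : 0 < n) (π π' : CuspidalAutomorphicRepData n F hF) :
    ∃ S₀ : Set (HeightOneSpectrum (𝓞 F)), S₀.Finite ∧
      ∀ {S : Set (HeightOneSpectrum (𝓞 F))} (_hS : S.Finite) (_hS₀ : S₀ ⊆ S)
        {α β : SatakeFamily F} (_hα : ∀ w ∉ S, π.1.HasSatakeParamAt w (α w))
        (_hβ : ∀ w ∉ S, π'.1.HasSatakeParamAt w (β w))
        (_hu : ∀ w ∉ S, ‖(α w).prod‖ = 1) (_hu' : ∀ w ∉ S, ‖(β w).prod‖ = 1)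
        {s₀ : ℂ} (_hs₀ : s₀.re = 1)
        (_hX : ∀ᶠ w in cofinite,
          (α w).map (((w.residueCard : ℂ) ^ (1 - s₀)) * ·) = (β w).map (·⁻¹)),
        ∃ c : ℂ, c ≠ 0 ∧
          Tendsto (fun s => (s - s₀) * partialPairL S α β s) (𝓝[{s : ℂ | 1 < s.re}] s₀) (𝓝 c) :=
  JacquetShalika1981_partialPairL_pole_repData_rank
    (fun _ _ => JacquetShalika1981_partialPairL_pole_of_eq_conj_holds_of_le_two hn2) hF hn π π'

/-! ### The named fact from its instances in rank `≥ 3`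

Since ranks `n ≤ 2` are unconditional (`JacquetShalika1981_partialPairL_pole_repData_rank_of_le_two`),
the named fact `JacquetShalika1981_partialPairL_pole_repData` is EQUIVALENT to its restriction to
ranks `n ≥ 3`; consumers (e.g. the isobaric bootstrap of the Langlands route, crux
`IrreducibleOffSector`) may therefore take the rank-`≥ 3` statement as their only (2.3)-input. -/

/-- **Arthur–Clozel (2.3) for Borel–Jacquet data in ranks `≥ 3` implies it in all ranks**: the
ranks `n ≤ 2` are the in-tree theorem `JacquetShalika1981_partialPairL_pole_repData_rank_of_le_two`.
[cite: ArthurClozelAMS120, Ch. 3 §2, (2.3), p. 171] -/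
theorem JacquetShalika1981_partialPairL_pole_repData_of_rank_three_le
    (h : ∀ (n : ℕ) (F : Type) [Field F] [NumberField F] (hF : isCompact_glFiniteIntegralLevel n F),
      3 ≤ n → ∀ (π π' : CuspidalAutomorphicRepData n F hF),
      ∃ S₀ : Set (HeightOneSpectrum (𝓞 F)), S₀.Finite ∧
        ∀ {S : Set (HeightOneSpectrum (𝓞 F))} (_hS : S.Finite) (_hS₀ : S₀ ⊆ S)
          {α β : SatakeFamily F} (_hα : ∀ w ∉ S, π.1.HasSatakeParamAt w (α w))
          (_hβ : ∀ w ∉ S, π'.1.HasSatakeParamAt w (β w))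
          (_hu : ∀ w ∉ S, ‖(α w).prod‖ = 1) (_hu' : ∀ w ∉ S, ‖(β w).prod‖ = 1)
          {s₀ : ℂ} (_hs₀ : s₀.re = 1)
          (_hX : ∀ᶠ w in cofinite,
            (α w).map (((w.residueCard : ℂ) ^ (1 - s₀)) * ·) = (β w).map (·⁻¹)),
          ∃ c : ℂ, c ≠ 0 ∧
            Tendsto (fun s => (s - s₀) * partialPairL S α β s) (𝓝[{s : ℂ | 1 < s.re}] s₀) (𝓝 c)) :
    JacquetShalika1981_partialPairL_pole_repData := by
  intro n F _ _ hF hn π π'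
  by_cases h3 : 3 ≤ n
  · exact h n F hF h3 π π'
  · exact JacquetShalika1981_partialPairL_pole_repData_rank_of_le_two (by omega) hF hn π π'

/-- **(2.3) for Borel–Jacquet data ⟺ (2.3) for Borel–Jacquet data in ranks `≥ 3`** (the converse
direction is specialisation). [cite: ArthurClozelAMS120, Ch. 3 §2, (2.3), p. 171] -/
theorem JacquetShalika1981_partialPairL_pole_repData_iff_rank_three_le :
    JacquetShalika1981_partialPairL_pole_repData ↔
      ∀ (n : ℕ) (F : Type) [Field F] [NumberField F] (hF : isCompact_glFiniteIntegralLevel n F),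
        3 ≤ n → ∀ (π π' : CuspidalAutomorphicRepData n F hF),
        ∃ S₀ : Set (HeightOneSpectrum (𝓞 F)), S₀.Finite ∧
          ∀ {S : Set (HeightOneSpectrum (𝓞 F))} (_hS : S.Finite) (_hS₀ : S₀ ⊆ S)
            {α β : SatakeFamily F} (_hα : ∀ w ∉ S, π.1.HasSatakeParamAt w (α w))
            (_hβ : ∀ w ∉ S, π'.1.HasSatakeParamAt w (β w))
            (_hu : ∀ w ∉ S, ‖(α w).prod‖ = 1) (_hu' : ∀ w ∉ S, ‖(β w).prod‖ = 1)
            {s₀ : ℂ} (_hs₀ : s₀.re = 1)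
            (_hX : ∀ᶠ w in cofinite,
              (α w).map (((w.residueCard : ℂ) ^ (1 - s₀)) * ·) = (β w).map (·⁻¹)),
            ∃ c : ℂ, c ≠ 0 ∧
              Tendsto (fun s => (s - s₀) * partialPairL S α β s) (𝓝[{s : ℂ | 1 < s.re}] s₀)
                (𝓝 c) :=
  ⟨fun h n F _ _ hF h3 π π' => h n F hF (by omega) π π',
    JacquetShalika1981_partialPairL_pole_repData_of_rank_three_le⟩

end Literature.NumberTheory.Automorphic
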